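import Mathlib
import Summits.NavierStokesRegularity.NavierStokesRegularity.Theorems.ThreadingFluxHorizonTowerMixedBracketCoreD
import Summits.NavierStokesRegularity.NavierStokesRegularity.Theorems.ThreadingFluxHorizonTowerZonalAssembly
import Summits.NavierStokesRegularity.NavierStokesRegularity.Theorems.ThreadingFluxHorizonTowerTwoShellZonalPartner
import HarnessLib

/-!
# Crux `PoloidalLiouville` (stmt-NavierStokesRegularity-1222, W1/W2), crux idea «horizon-threading-tower» (ns-idea-15):
# ★★★ MIXED-DEGREE BRACKET RIGIDITY — Poisson-commuting solid harmonics of different degrees are coaxially zonal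
# (two-shell horizon towers pass the ORDER-ONE law only if axisymmetric without swirl)

Support file (`--supports stmt-NavierStokesRegularity-1222`, helper; cell `ns-wall-extremal`, width hand ns-wall-eng-3 g3; 0 kit).
THEOREM `Zonal.mixedDegreeBracketRigidity`: `A ∈ 𝓗_l`, `B ∈ 𝓗_m` real solid harmonics on `ℝ³`, both non-zero, `l ≠ m`, `l, m ≥ 1`,
`det(y, ∇A(y), ∇B(y)) = 0` for all `y` ⇒ there is `n ≠ 0` with `⟪n × x, ∇A(x)⟫ ≡ 0` and `⟪n × x, ∇B(x)⟫ ≡ 0`.  Together with the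
same-degree theorem `LoopLaw.sameDegreeBracketRigidity` (p684047: proportional) this classifies all Poisson-commuting pairs of solid
harmonics on spheres.  For ns-idea-15's «horizon-threading-tower»: the order-one horizon law of a scale-free two-shell profile
`U = U_{H_l} + U_{H_m}` is `{H_l, H_m} ≡ 0` (`OrderOneSphereEuler`, p679165), so TWO-SHELL TOWERS ARE DECIDED AT ORDER ONE: coaxially
zonal (axisymmetric without swirl, then also annihilated by `𝔏₂`, `horizonL2Zonal` p676078) or threaded — the two-shell case of the
conjecture `HorizonTower.HorizonTowerZonality` (ThreadingFluxHorizonTowerDefs l.254).  The general (infinitely many shells / smooth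
profile) conjecture is NOT touched.
PROOF: polynomial core `dP_eq_zero_of_mixed_bracket` (`…MixedBracketCoreA–D`: `A` is det-zonal), ns-wall-eng-5 g4's isotropic frame and
top-weight descent (`exists_orthonormal_isotropic_zero`, `rotP_eq_zero_of_real`, `inner_cross_gradient_of_frame`, exactly as in
`detZonal_allDegrees`), and the zonal-partner lemma `zonal_partner_of_bracket` (p688869).
HONEST FRAME: finite-dimensional algebra about one crux idea's typed objects, information-grade for W1; `HorizonTowerZonality`
(general), `PoloidalLiouville` (1222), `UnthreadedRigidity` (27585), 23843 and NS regularity remain OPEN; W1/W2 movement 0.  [folklore]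
-/

-- the summit and its single problem share the name (D-0017 nested layout)
set_option linter.dupNamespace false

noncomputable section

open MvPolynomial Finsupp

namespace Summit.NavierStokesRegularity.NavierStokesRegularity.Theorems.PoloidalLiouville.HorizonTower.Zonal

section MixedRigidity

open scoped RealInnerProductSpace
open Complex
open Literature.Analysis.FluidPDE (cross)
open Literature.Geometry.DiscreteGeometry (inner_fin3 norm_sq_fin3)

/-- ★★★ **MIXED-DEGREE BRACKET RIGIDITY** (two-shell horizon towers at order one): two non-zero real solid harmonics `A`, `B` on `ℝ³`
of DIFFERENT degrees `l ≠ m` (`l, m ≥ 1`) whose loop bracket `det(y, ∇A(y), ∇B(y))` vanishes identically are BOTH axisymmetric about a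
common axis `n ≠ 0` (`⟪n × x, ∇A(x)⟫ ≡ 0 ≡ ⟪n × x, ∇B(x)⟫`).  With the same-degree theorem `LoopLaw.sameDegreeBracketRigidity`
(p684047) this classifies ALL Poisson-commuting pairs of solid harmonics: proportional (same degree) or coaxially zonal.  Reading for
the horizon card: by `OrderOneSphereEuler` the order-one law of the two-shell profile `U = U_{H_l} + U_{H_m}` is `{H_l, H_m} ≡ 0`, so a
two-shell tower passes ORDER ONE only if it is axisymmetric without swirl — and then it passes order two as well (`horizonL2Zonal`).  Proof:
the polynomial core `dP_eq_zero_of_mixed_bracket` makes `A` det-zonal; ns-wall-eng-5 g4's isotropic frame + top-weight descent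
(`exists_orthonormal_isotropic_zero`, `rotP_eq_zero_of_real`, `inner_cross_gradient_of_frame`) make `A` axisymmetric about `u × v`; the
zonal-partner lemma `zonal_partner_of_bracket` (p688869) transfers the axis to `B`. -/
theorem mixedDegreeBracketRigidity (l m : ℕ) (A B : MvPolynomial (Fin 3) ℝ) (hl : 1 ≤ l) (hm : 1 ≤ m) (hlm : l ≠ m)
    (hA : A.IsHomogeneous l ∧ ∀ y : E3, Laplacian.laplacian (fun y : E3 => MvPolynomial.eval (fun i => y i) A) y = 0)
    (hB : B.IsHomogeneous m ∧ ∀ y : E3, Laplacian.laplacian (fun y : E3 => MvPolynomial.eval (fun i => y i) B) y = 0)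
    (hA0 : A ≠ 0) (hB0 : B ≠ 0)
    (hbr : ∀ y : E3, inner ℝ y (cross (gradient (fun y : E3 => MvPolynomial.eval (fun i => y i) A) y)
      (gradient (fun y : E3 => MvPolynomial.eval (fun i => y i) B) y)) = 0) :
    ∃ n : E3, n ≠ 0 ∧ (∀ x : E3, ⟪cross n x, gradient (fun y : E3 => MvPolynomial.eval (fun i => y i) A) x⟫ = 0) ∧
      (∀ x : E3, ⟪cross n x, gradient (fun y : E3 => MvPolynomial.eval (fun i => y i) B) x⟫ = 0) := by
  classical
  obtain ⟨hAh, hAlap⟩ := hA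
  obtain ⟨hBh, hBlap⟩ := hB
  have eA : (fun y : E3 => MvPolynomial.eval (fun i => y i) A) = evalE A := rfl
  have eB : (fun y : E3 => MvPolynomial.eval (fun i => y i) B) = evalE B := rfl
  rw [eA] at hAlap hbr ⊢
  rw [eB] at hBlap hbr ⊢
  -- polynomial identities
  have hlapA : lapP A = 0 := eq_zero_of_evalE_eq_zero fun y => by rw [← laplacian_evalE]; exact hAlap y
  have hlapB : lapP B = 0 := eq_zero_of_evalE_eq_zero fun y => by rw [← laplacian_evalE]; exact hBlap y
  have hdet : detP A B = 0 := eq_zero_of_evalE_eq_zero fun y => by rw [← LoopLaw.loopBracket_evalE]; exact hbr y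
  -- the core: `A` is det-zonal
  have hDP : DP A = 0 := dP_eq_zero_of_mixed_bracket hl hm hlm hAh hBh hlapA hlapB hA0 hB0 hdet
  have hdetfun : ∀ x : E3, x ≠ 0 → ⟪gradient (evalE A) x, cross (gradient (fun w : E3 => ‖gradient (evalE A) w‖ ^ 2) x) x⟫ = 0 := by
    intro x _; rw [det_evalE, hDP, evalE_zero]
  -- eng-5 g4's isotropic frame and top-weight descent (as in `detZonal_allDegrees`)
  obtain ⟨u, v, hu, hv, huv, hzero⟩ := exists_orthonormal_isotropic_zero A hAh hl
  set K : E3 → ℝ := fun y => evalE A ((frameIso hu hv huv).symm y) with hK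
  set lin : Fin 3 → MvPolynomial (Fin 3) ℝ := fun j => ∑ i : Fin 3, C ((frameVec u v i) j) * X i with hlin
  set q : MvPolynomial (Fin 3) ℝ := bind₁ lin A with hq
  have hqh : q.IsHomogeneous l := by
    have h1 : ∀ j, (lin j).IsHomogeneous 1 := fun j =>
      MvPolynomial.IsHomogeneous.sum _ _ _ fun i _ => (isHomogeneous_X ℝ i).C_mul _
    have := hAh.aeval lin h1
    rw [one_mul] at this
    rw [hq, ← aeval_eq_bind₁]; exact this
  have hKq : ∀ y, K y = evalE q y := by
    intro y
    rw [hK, hq]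
    simp only
    rw [evalE, evalE]
    change _ = eval₂Hom (RingHom.id ℝ) (fun i => y i) (bind₁ lin A)
    rw [eval₂Hom_bind₁]
    change eval (fun i => ((frameIso hu hv huv).symm y) i) A = eval (fun j => eval (fun i => y i) (lin j)) A
    have harg : (fun i => ((frameIso hu hv huv).symm y) i) = fun j => eval (fun i => y i) (lin j) := by
      funext j
      rw [frameIso_symm_apply, hlin]
      simp [Fin.sum_univ_three]
      ring
    rw [harg]
  have hKfun : K = evalE q := funext hKq
  have hlapq : lapP q = 0 := by
    refine eq_zero_of_evalE_eq_zero fun y => ?_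
    rw [← laplacian_evalE, ← hKfun]
    exact harmonic_comp_frameIso_symm hu hv huv hAlap y
  have hDq : DP q = 0 := by
    refine eq_zero_of_evalE_eq_zero fun y => ?_
    rw [← det_evalE, ← hKfun]
    by_cases hy : y = 0
    · obtain ⟨c0, c1, c2⟩ := cross_fin3 (gradient (fun w : E3 => ‖gradient K w‖ ^ 2) y) y
      rw [inner_fin3, c0, c1, c2, hy]
      simp
    · exact detZonal_comp_frameIso_symm hu hv huv hdetfun y hy
  have hiso : eval ![1, I, 0] (map (algebraMap ℝ ℂ) q) = 0 := by
    rw [hq, map_bind₁]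
    change eval₂Hom (RingHom.id ℂ) ![1, I, 0] (bind₁ _ _) = 0
    rw [eval₂Hom_bind₁]
    change eval (fun j => eval ![1, I, 0] (map (algebraMap ℝ ℂ) (lin j))) (map (algebraMap ℝ ℂ) A) = 0
    have harg : (fun j => eval ![1, I, 0] (map (algebraMap ℝ ℂ) (lin j))) = fun i => ((u i : ℝ) : ℂ) + ((v i : ℝ) : ℂ) * I := by
      funext j
      rw [hlin]
      simp [Fin.sum_univ_three]
    rw [harg]
    exact hzero
  have hrot : rotP q = 0 := rotP_eq_zero_of_real hqh hlapq hDq hiso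
  have hKrot : ∀ y : E3, ⟪cross (EuclideanSpace.single 2 (1 : ℝ)) y, gradient K y⟫ = 0 := by
    intro y; rw [hKfun, rot_evalE, hrot, evalE_zero]
  have hArot : ∀ x : E3, ⟪cross (cross u v) x, gradient (evalE A) x⟫ = 0 := inner_cross_gradient_of_frame hu hv huv hKrot
  -- the partner
  have hBrot := zonal_partner_of_bracket l m A B hu hv huv hl hAh hAlap hA0 hBh hBlap hArot hbr
  have hn : cross u v ≠ 0 := by
    intro h
    have h1 : ‖cross u v‖ ^ 2 = 1 := by rw [norm_cross_sq, hu, hv, huv]; norm_num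
    rw [h, norm_zero] at h1
    norm_num at h1
  exact ⟨cross u v, hn, hArot, hBrot⟩

end MixedRigidity

end Summit.NavierStokesRegularity.NavierStokesRegularity.Theorems.PoloidalLiouville.HorizonTower.Zonal

end
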